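import Summits.QuantumFields.BalabanUV.T4Continuum.Support.VariationalVectorAvgGProjGData
import Summits.QuantumFields.BalabanUV.T4Continuum.Support.CompositeTaxiFrameGap
import Summits.QuantumFields.BalabanUV.T4Continuum.Support.CompositeFibreMismatch
import Summits.QuantumFields.BalabanUV.T4Continuum.Support.CompositeFibreRelabel
import Summits.QuantumFields.BalabanUV.T4Continuum.Support.VariationalVectorLandauTower

/-!
# T⁴ programme, spine node NE2 (U1a), lane P2 — «V-AVG-G AT TAXI DATA», file 2: (G″) «V-AVG-G» FOR BAŁABAN's COVARIANT PROJECTED GAUGE FUNCTIONAL AT BAŁABAN's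
# TAXI DATA, STRAIGHT-TAXI KERNELS ON BOTH LEVELS, FROM OPERATOR DATA ALONE — gen 4's `avgG_projG_of_data` at taxi data followed by the composite ↔ straight-taxi
# kernel swap WITH COEFFICIENT ONE (model level; cell `pub-balaban`)

NE2 formalisation swarm `b2b-balaban-t4-ne2-formalise-*`, leaf prover 10 GEN 5 (`prover-b2b-balaban-t4-ne2-formalise-leaf-10-g5-0`, V-END holder lineage); item
«V-AVG-G AT TAXI DATA» (CLAIMS.log 2026-08-20, ONLINE gen 5), file F2.  Composition BY NAME of: gen 4's `VariationalVectorAvgGProjGData.avgG_projG_of_data` (p235634: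
(G″) for `projG` with NESTED scalar kernels from operator data), gen 2∕4's taxi lemmas `VariationalColourTaxi{Transport,Lines}.{inBlock_defect_taxiTv_adjoint_le,
norm_misv_taxi_le, hin_taxiTv_le, hcross_taxiTv_le}` + `VariationalColourTaxiTowerLeaves.inBlock_blockOf_of_bpt` (the pointwise data at taxi data), leaf-03-g7's
`CompositeFibreRelabel.projG_compFibre_eq` (the nested kernel IS the two-step taxi's kernel read on the composite torus) and `CompositeFibreMismatch.sqrt_projG_le_of_frames`
(the square-root ∕ coefficient-one comparison of two gauge fixings), leaf-04-g7's `CompositeTaxiFrameGap.{taxiTv_Rtrv_sub_compTv_le, inBlock_defect_compTv_blockOf,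
inBlock_defect_taxiTv_Rtrv_blockOf, Rtrv_mem_unitary_of, plaq_Rtrv_le}` (the frame distance and the two mismatch classes) and leaf-10-g3's
`VariationalVectorLandauTower.divSq_transport`; nothing defined.

THE STATEMENT (`avgG_projG_taxi`, level `n`, block side `L`, finite-dimensional Hilbert fibre `E`).  DATA: UNITARY one-step bonds `S` on `Tor (fine L (fine n M))`
(plaquette defect `a`), their straight coarsening `C := coarseTv L _ S` (plaquette defect `a_C`), `1 < M_μ`; FOUR smallness numbers of the taxi class —
`2d(n·(d−1)(n−1)a_C)² ≤ ½` (coarse taxi in-block class), `2d(L·(d−1)(L−1)a)² ≤ ½` (one-step taxi), `64d(n·(d−1)L(L−1)a)² ≤ ½` (FED⁺'s mismatch), and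
`2d((n·L)·((d−1)(L−1)(2L−1)a + (d−1)(n−1)a_C))² ≤ ½` (the two-step frames' in-block class — the ONE place where the Poincaré inequality on the COMPOSITE kernel is
used).  THEN for every fine 1-form `g`, with the straight taxis `T := taxiTv n M C`, `T′ := taxiTv L _ S`, `T⁺ := taxiTv (n·L) M (Rtrv S)`, the product line carriers
`lineT T′ S`, and Bałaban's projected functionals `G := projG C (ker Q_T)` (level `n`), `G⁺ := projG (Rtrv S) (ker Q_{T⁺})` (level `n·L`, composite torus):
  `(n^d)⁻¹(n²·G(Q_{lineT T′ S} g)) ≤ ( √(((nL)^d)⁻¹((nL)²·G⁺(g ∘ sites))) + ε″·√(ρ_D + ((nL)^d)⁻¹((nL)²·divSq S g)) )²`,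
  `ε″ = ε_D + √(136·e_H) + 4·d(d(L(n−1)(L−1)a))·revPC d (n·L) ((d−1)(n·L−1)a)`,
with `ε_D`, `e_H`, `ρ_D` LITERALLY gen 4's (`ε_D = √(3d)(2n⁻¹ + m + n m)`, `m = (d−1)L(L−1)a`, `m₁ = (d−1)(L−1)(2L−1)a`, `w₀ = (d−1)(n−1)a_C`, `n·w′ = n·w₀ + 3`, `γ = 0`).
PROOF: `avgG_projG_of_data` at (`Rc := C`, `T = T₀ := taxiTv n M C`, `T′`, `R′ := S`) gives the square-root shape with the NESTED kernel `ker(Q_T ∘ Q_{T′})` on the fine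
side; `projG_compFibre_eq` reads it as `projG (Rtrv S) (ker Q_{compTv T T′}) (g ∘ sites)`; `sqrt_projG_le_of_frames` with `T₁ :=` the two-step frames `compTv T T′`
(mismatch class `inBlock_defect_compTv_blockOf`, the fourth smallness), `T₂ := T⁺` (class `inBlock_defect_taxiTv_Rtrv_blockOf`), `‖T₁ − T₂‖ ≤ d(d(L(n−1)(L−1)a))`
(`taxiTv_Rtrv_sub_compTv_le`) moves to the straight taxi AT COEFFICIENT ONE, the price `4τ·revPC·√divSq` being absorbed into `ε″·√ρ′` because `((nL)^d)⁻¹((nL)²·divSq)`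
IS the last summand of `ρ′` (`divSq_transport`).  §3 reads the per-level statement along the taxi tower (`Rlev`, `nestLv`, coherence `coarseTv (R′ k) = Rlev k`): it is the
END's `hAVGG k` (file 1 `towerLimitRate_effV_taxiTower_avgG`, parts 6–8's `G k := projG (Rlev k) (ker Q_{taxi,k})`, `G′ k := G (k+1) ∘ (· ∘ sites)`) AT EVERY PAIR — no
minimality is used.  The class reading `ε″_k ≤ c_ε″·θ^k` (`θ² ≥ L⁻¹`; the half exponent sits in `√e_H` only) is the next file.

HONEST FRAMING (T4-DAG p. 1).  Model level (c5 — bond ∕ site operators DATA, taxi contours and the straight-taxi gauge fixing OURS; no identification with Bałaban's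
`R_k(U)`); composition of landed lemmas + one line of real algebra; nothing printed is a hypothesis; no `def`, no `def … : Prop`, no `sorry`; axioms standard.  NOT an
END statement; V-REG′ of `ρ′` and (ONE-min) with background stay displayed in the host; the thresholds (`revPC`, `36^d`) are quantitatively void (memo GF3COV §3);
V-END with background ∕ NE2 NOT proved; NE3 OPEN; spine PROVED 0∕9 unchanged; rung (B)+1 on a fixed finite T⁴ — NOT infinite volume, NOT mass gap, NOT Clay.  HONEST
DEPENDENCY (cell, verbatim): continuum YM on T⁴ ⇐ BetaPertH ∧ nine spine estimates (0/9 proved); BetaPertH ⇐ (D1) ∧ (D4) ∧ CAP+tail; G-an2-4 gates asym, D1 and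
NE2/3/4.
-/

noncomputable section

namespace Summit.QuantumFields.BalabanUV.T4Continuum.VariationalColourTaxiTowerAvgGData

open Finset WithLp
open Literature.MathematicalPhysics.QuantumFieldTheory.Balaban1983to89.B5Prop11Plancherel (Tor fine unitVec)
open Literature.MathematicalPhysics.QuantumFieldTheory.Balaban1983to89.B5Block118 (bpt)
open Literature.MathematicalPhysics.QuantumFieldTheory.Balaban1983to89.B5Blocks16 (blockOf)
open Literature.MathematicalPhysics.QuantumFieldTheory.Balaban1983to89.B5Composition116 (sites)
open Summit.QuantumFields.BalabanUV.T4Continuum.VariationalColourFederbush (misv Qcv norm_le_one_of_mem_unitary)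
open Summit.QuantumFields.BalabanUV.T4Continuum.VariationalColourTower (Rtrv compTv compTv_mem_unitary)
open Summit.QuantumFields.BalabanUV.T4Continuum.VariationalColourTaxiTransport
open Summit.QuantumFields.BalabanUV.T4Continuum.VariationalVectorEndOfLeaves (eV ePV)
open Summit.QuantumFields.BalabanUV.T4Continuum.VariationalVectorOneStep (hessV)
open Summit.QuantumFields.BalabanUV.T4Continuum.VectorBlockTrialForm (QvL)
open Summit.QuantumFields.BalabanUV.T4Continuum.VariationalVectorForm (cdV qVV qVV_nonneg)
open Summit.QuantumFields.BalabanUV.T4Continuum.VariationalVectorFederbush (lineT)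
open Summit.QuantumFields.BalabanUV.T4Continuum.VariationalVectorWeitzenbock (divSq divSq_nonneg)
open Summit.QuantumFields.BalabanUV.T4Continuum.VariationalVectorGaugeSlice (projG avgOp projG_nonneg)
open Summit.QuantumFields.BalabanUV.T4Continuum.VariationalColourInterpolant (hessv_nonneg)
open Summit.QuantumFields.BalabanUV.T4Continuum.VariationalVectorAvgGProjGData (avgG_projG_of_data)
open Summit.QuantumFields.BalabanUV.T4Continuum.CompositeTaxiFrameGap
  (taxiTv_Rtrv_sub_compTv_le inBlock_defect_compTv_blockOf inBlock_defect_taxiTv_Rtrv_blockOf Rtrv_mem_unitary_of plaq_Rtrv_le)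
open Summit.QuantumFields.BalabanUV.T4Continuum.CompositeFibreMismatch (sqrt_projG_le_of_frames)
open Summit.QuantumFields.BalabanUV.T4Continuum.CompositeFibreRelabel (projG_compFibre_eq)
open Summit.QuantumFields.BalabanUV.T4Continuum.VariationalVectorLandauTower (divSq_transport)
open Summit.QuantumFields.BalabanUV.T4Continuum.CovariantBlockReversePoincare (revPC revPC_nonneg)

variable {d : ℕ}

/-! ## §1 Two lines of real algebra -/

/-- **the kernel swap under the square root, the swap's price absorbed into the regularity term**: from `A ≤ (√(c₁(c₂B₁)) + e·√(ρ + c₁(c₂D)))²`,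
`√B₁ ≤ √B₂ + δ·√D`, and `0 ≤ c₁, c₂, ρ, δ, e`, conclude `A ≤ (√(c₁(c₂B₂)) + (e + δ)·√(ρ + c₁(c₂D)))²` (`√(c₁c₂D) ≤ √(ρ + c₁c₂D)`). [folklore] -/
theorem sq_sqrt_swap_le {A B₁ B₂ D ρ c₁ c₂ e δ : ℝ} (hc₁ : 0 ≤ c₁) (hc₂ : 0 ≤ c₂) (hρ : 0 ≤ ρ) (hδ : 0 ≤ δ) (he : 0 ≤ e)
    (h1 : A ≤ (Real.sqrt (c₁ * (c₂ * B₁)) + e * Real.sqrt (ρ + c₁ * (c₂ * D))) ^ 2) (h2 : Real.sqrt B₁ ≤ Real.sqrt B₂ + δ * Real.sqrt D) :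
    A ≤ (Real.sqrt (c₁ * (c₂ * B₂)) + (e + δ) * Real.sqrt (ρ + c₁ * (c₂ * D))) ^ 2 := by
  have hc : 0 ≤ c₁ * c₂ := mul_nonneg hc₁ hc₂
  have hsc : 0 ≤ Real.sqrt (c₁ * c₂) := Real.sqrt_nonneg _
  have e1 : ∀ X : ℝ, c₁ * (c₂ * X) = c₁ * c₂ * X := fun X => by ring
  have hr : Real.sqrt (c₁ * c₂ * D) ≤ Real.sqrt (ρ + c₁ * (c₂ * D)) := Real.sqrt_le_sqrt (by rw [e1]; linarith)
  have h3 : Real.sqrt (c₁ * (c₂ * B₁)) ≤ Real.sqrt (c₁ * (c₂ * B₂)) + δ * Real.sqrt (ρ + c₁ * (c₂ * D)) := by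
    rw [e1, e1, Real.sqrt_mul hc, Real.sqrt_mul hc]
    have h4 : Real.sqrt (c₁ * c₂) * Real.sqrt B₁ ≤ Real.sqrt (c₁ * c₂) * (Real.sqrt B₂ + δ * Real.sqrt D) := mul_le_mul_of_nonneg_left h2 hsc
    have h5 : Real.sqrt (c₁ * c₂) * (δ * Real.sqrt D) = δ * Real.sqrt (c₁ * c₂ * D) := by rw [Real.sqrt_mul hc]; ring
    have h6 : δ * Real.sqrt (c₁ * c₂ * D) ≤ δ * Real.sqrt (ρ + c₁ * (c₂ * D)) := mul_le_mul_of_nonneg_left hr hδ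
    linarith [h4, h5, h6]
  have hX0 : 0 ≤ Real.sqrt (c₁ * (c₂ * B₁)) + e * Real.sqrt (ρ + c₁ * (c₂ * D)) := by positivity
  have hXY : Real.sqrt (c₁ * (c₂ * B₁)) + e * Real.sqrt (ρ + c₁ * (c₂ * D)) ≤ Real.sqrt (c₁ * (c₂ * B₂)) + (e + δ) * Real.sqrt (ρ + c₁ * (c₂ * D)) := by
    nlinarith [h3, Real.sqrt_nonneg (ρ + c₁ * (c₂ * D))]
  exact h1.trans (pow_le_pow_left₀ hX0 hXY 2)

/-- `1 < n·M_μ` on the refined torus (`1 ≤ n`, `1 < M_μ`). [folklore] -/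
theorem one_lt_fine (n : ℕ) [NeZero n] (M : Fin d → ℕ) (hM2 : ∀ μ, 1 < M μ) (μ : Fin d) : 1 < fine n M μ := by
  show 1 < n * M μ
  have hn : 1 ≤ n := Nat.one_le_iff_ne_zero.mpr (NeZero.ne n)
  calc 1 < M μ := hM2 μ
    _ = 1 * M μ := (one_mul _).symm
    _ ≤ n * M μ := Nat.mul_le_mul_right _ hn

/-! ## §2 (G″) at taxi data, straight-taxi kernels on both levels, per level -/

section Level

variable {E : Type*} [NormedAddCommGroup E] [InnerProductSpace ℂ E] [CompleteSpace E] [FiniteDimensional ℂ E]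
variable (n L : ℕ) [NeZero n] [NeZero L] (M : Fin d → ℕ) [hM : ∀ μ, NeZero (M μ)]

/-- **(G″) «V-AVG-G» FOR BAŁABAN's PROJECTED GAUGE FUNCTIONAL AT TAXI DATA, STRAIGHT-TAXI KERNELS ON BOTH LEVELS, FROM OPERATOR DATA ALONE**:
`(n^d)⁻¹(n²·G_{ker Q_{taxi n C}}(Q_{lineT taxi′ S} g)) ≤ (√(((nL)^d)⁻¹((nL)²·G⁺_{ker Q_{taxi (nL) (Rtrv S)}}(g ∘ sites))) + ε″·√(ρ_D + ((nL)^d)⁻¹((nL)²·divSq S g)))²`,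
`ε″ = ε_D + √(136·e_H) + 4·d(d(L(n−1)(L−1)a))·revPC d (n·L) ((d−1)(n·L−1)a)` — gen 4's `avgG_projG_of_data` at taxi data, then the composite ↦ straight-taxi kernel swap at
coefficient one (`projG_compFibre_eq` + `sqrt_projG_le_of_frames`). [folklore] -/
theorem avgG_projG_taxi (hM2 : ∀ μ, 1 < M μ) {S : Tor (fine L (fine n M)) → Fin d → (E →L[ℂ] E)} (hU : ∀ x μ, S x μ ∈ unitary (E →L[ℂ] E))
    {a aC : ℝ} (ha0 : 0 ≤ a) (haC0 : 0 ≤ aC)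
    (ha : ∀ x κ ι, ‖S x κ * S (x + unitVec (fine L (fine n M)) κ) ι - S x ι * S (x + unitVec (fine L (fine n M)) ι) κ‖ ≤ a)
    (haC : ∀ y κ ι, ‖coarseTv L (fine n M) S y κ * coarseTv L (fine n M) S (y + unitVec (fine n M) κ) ι
      - coarseTv L (fine n M) S y ι * coarseTv L (fine n M) S (y + unitVec (fine n M) ι) κ‖ ≤ aC)
    -- the four smallness numbers of the taxi class
    (hsmallC : 2 * (d : ℝ) * ((n : ℝ) * (((d - 1 : ℕ) : ℝ) * ((n - 1 : ℕ) : ℝ) * aC)) ^ 2 ≤ 1 / 2)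
    (hsmall₁ : 2 * (d : ℝ) * ((L : ℝ) * (((d - 1 : ℕ) : ℝ) * ((L - 1 : ℕ) : ℝ) * a)) ^ 2 ≤ 1 / 2)
    (habsorb : 64 * (d : ℝ) * ((n : ℝ) * (((d - 1 : ℕ) : ℝ) * L * ((L - 1 : ℕ) : ℝ) * a)) ^ 2 ≤ 1 / 2)
    (hsmallcp : 2 * (d : ℝ) * ((((n * L : ℕ) : ℝ))
      * (((d - 1 : ℕ) : ℝ) * ((L - 1 : ℕ) : ℝ) * ((2 * L - 1 : ℕ) : ℝ) * a + ((d - 1 : ℕ) : ℝ) * ((n - 1 : ℕ) : ℝ) * aC)) ^ 2 ≤ 1 / 2)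
    (g : Tor (fine L (fine n M)) → Fin d → E) :
    let w₀ : ℝ := ((d - 1 : ℕ) : ℝ) * ((n - 1 : ℕ) : ℝ) * aC
    let w' : ℝ := w₀ + 3 / (n : ℝ)
    let m : ℝ := ((d - 1 : ℕ) : ℝ) * L * ((L - 1 : ℕ) : ℝ) * a
    let m₁ : ℝ := ((d - 1 : ℕ) : ℝ) * ((L - 1 : ℕ) : ℝ) * ((2 * L - 1 : ℕ) : ℝ) * a
    let Λc : ℝ := 2 * d * (36 : ℝ) ^ d * ((1 + n * w') ^ 2 + 9)
    let CP : ℝ := 136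
    let CR : ℝ := 2 * Λc + 2 * d * (aC * (n : ℝ) ^ 2) + (d : ℝ) ^ 2 * (aC * (n : ℝ) ^ 2) ^ 2 * CP
    let ε₁ : ℝ := ((d : ℝ) / 4 + 1 / 2) * ((L : ℝ) / (n : ℝ) ^ 2)
    let δ' : ℝ := Real.sqrt (2 * d * (1 + (d : ℝ) ^ 2)) * ((n : ℝ) * L * m₁)
    let Λ : ℝ := Λc + (ε₁ * CR + 2 * δ' * Real.sqrt ((1 + ε₁ * CR) * CP) + δ' ^ 2 * CP) * (Λc + 1)
    let δ : ℝ := Real.sqrt d * ((n : ℝ) * m)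
    let eH : ℝ := ePV Λ CP CR ε₁ δ' + eV Λ CP δ
    let εD : ℝ := Real.sqrt (3 * d) * (2 * (n : ℝ)⁻¹ + m + n * m)
    let δG : ℝ := 4 * ((d : ℝ) * ((d : ℝ) * (((L : ℝ) * ((n - 1 : ℕ) : ℝ) * ((L - 1 : ℕ) : ℝ)) * a))) * revPC d (n * L) (((d - 1 : ℕ) : ℝ) * ((n * L - 1 : ℕ) : ℝ) * a)
    let ρD : ℝ := (((n : ℝ) * L) ^ 4 / ((n : ℝ) * L) ^ d) * hessV (fine L (fine n M)) S g
      + (((n : ℝ) * L) ^ 2 / ((n : ℝ) * L) ^ d) * ∑ μ : Fin d, ∑ x : Tor (fine L (fine n M)), ‖cdV (fine L (fine n M)) S g x μ μ‖ ^ 2 + qVV n L M g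
    ((n : ℝ) ^ d)⁻¹ * ((n : ℝ) ^ 2 * projG (fine n M) (coarseTv L (fine n M) S) (LinearMap.ker (avgOp n M (taxiTv n M (coarseTv L (fine n M) S))))
        (QvL L (fine n M) (lineT L (fine n M) (taxiTv L (fine n M) S) S) g))
      ≤ (Real.sqrt ((((n : ℝ) * L) ^ d)⁻¹ * (((n : ℝ) * L) ^ 2
              * projG (fine (n * L) M) (Rtrv n L M S) (LinearMap.ker (avgOp (n * L) M (taxiTv (n * L) M (Rtrv n L M S)))) (g ∘ sites n L M)))
          + (εD + Real.sqrt (CP * eH) + δG) * Real.sqrt (ρD + (((n : ℝ) * L) ^ d)⁻¹ * (((n : ℝ) * L) ^ 2 * divSq (fine L (fine n M)) S g))) ^ 2 := by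
  intro w₀ w' m m₁ Λc CP CR ε₁ δ' Λ δ eH εD δG ρD
  have hn0 : (0 : ℝ) < n := by exact_mod_cast Nat.pos_of_ne_zero (NeZero.ne n)
  have hd0 : (0 : ℝ) ≤ d := Nat.cast_nonneg d
  have hS1 : ∀ x μ, ‖S x μ‖ ≤ 1 := fun x μ => norm_le_one_of_mem_unitary (hU x μ)
  -- the straight coarsening and the two straight taxis are unitary
  have hUC : ∀ y μ, coarseTv L (fine n M) S y μ ∈ unitary (E →L[ℂ] E) := coarseTv_mem_unitary L (fine n M) hU
  have hT : ∀ x, taxiTv n M (coarseTv L (fine n M) S) x ∈ unitary (E →L[ℂ] E) := taxiTv_mem_unitary n M hUC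
  have hT' : ∀ x, taxiTv L (fine n M) S x ∈ unitary (E →L[ℂ] E) := taxiTv_mem_unitary L (fine n M) hU
  -- the pointwise data of `avgG_projG_of_data` at taxi data
  have hw0 : 0 ≤ w₀ := by positivity
  have hw₀ : ∀ (x : Tor (fine n M)) (μ : Fin d), blockOf n M (x + unitVec (fine n M) μ) = blockOf n M x →
      ‖coarseTv L (fine n M) S x μ * star (taxiTv n M (coarseTv L (fine n M) S) (x + unitVec (fine n M) μ)) * taxiTv n M (coarseTv L (fine n M) S) x - 1‖ ≤ w₀ :=
    fun x μ hx => inBlock_blockOf_of_bpt n M hM2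
      (P := fun x μ => ‖coarseTv L (fine n M) S x μ * star (taxiTv n M (coarseTv L (fine n M) S) (x + unitVec (fine n M) μ))
        * taxiTv n M (coarseTv L (fine n M) S) x - 1‖ ≤ w₀)
      (fun y j μ hj => inBlock_defect_taxiTv_adjoint_le n M hUC haC y j μ hj) x μ hx
  have hrel : ∀ x, ‖taxiTv n M (coarseTv L (fine n M) S) x * star (taxiTv n M (coarseTv L (fine n M) S) x) - 1‖ ≤ (0 : ℝ) := fun x => by
    rw [Unitary.mul_star_self_of_mem (hT x), sub_self, norm_zero]
  have hsmall : 2 * (d : ℝ) * ((n : ℝ) * w₀) ^ 2 + 4 * (0 : ℝ) ^ 2 ≤ 1 / 2 := by simpa using hsmallC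
  have hw'0 : 0 ≤ w' := by positivity
  have hw' : (4 + n * w₀) / (1 - 0) - 1 ≤ n * w' := by
    have : (n : ℝ) * w' = n * w₀ + 3 := by
      show (n : ℝ) * (w₀ + 3 / (n : ℝ)) = n * w₀ + 3
      field_simp
    rw [this, sub_zero, div_one]; linarith
  have hw₁ : ∀ (x : Tor (fine L (fine n M))) (μ : Fin d), blockOf L (fine n M) (x + unitVec (fine L (fine n M)) μ) = blockOf L (fine n M) x →
      ‖S x μ * star (taxiTv L (fine n M) S (x + unitVec (fine L (fine n M)) μ)) * taxiTv L (fine n M) S x - 1‖ ≤ ((d - 1 : ℕ) : ℝ) * ((L - 1 : ℕ) : ℝ) * a :=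
    fun x μ hx => inBlock_blockOf_of_bpt L (fine n M) (one_lt_fine n M hM2)
      (P := fun x μ => ‖S x μ * star (taxiTv L (fine n M) S (x + unitVec (fine L (fine n M)) μ)) * taxiTv L (fine n M) S x - 1‖ ≤ ((d - 1 : ℕ) : ℝ) * ((L - 1 : ℕ) : ℝ) * a)
      (fun y j μ hj => inBlock_defect_taxiTv_adjoint_le L (fine n M) hU ha y j μ hj) x μ hx
  have hsmall₁' : 2 * (d : ℝ) * ((L : ℝ) * (((d - 1 : ℕ) : ℝ) * ((L - 1 : ℕ) : ℝ) * a)) ^ 2 ≤ 1 / 2 := hsmall₁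
  have hm : 0 ≤ m := by positivity
  have hmis : ∀ y μ j, ‖misv L (fine n M) (coarseTv L (fine n M) S) S (taxiTv L (fine n M) S) y μ j‖ ≤ m :=
    fun y μ j => norm_misv_taxi_le L (fine n M) hS1 ha y μ j
  have hm₁ : 0 ≤ m₁ := by positivity
  have hLm1 : ((d - 1 : ℕ) : ℝ) * ((L - 1 : ℕ) : ℝ) * a ≤ m₁ := by
    have h2L : (1 : ℝ) ≤ ((2 * L - 1 : ℕ) : ℝ) := by
      have hL1 : 1 ≤ L := Nat.one_le_iff_ne_zero.mpr (NeZero.ne L)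
      exact_mod_cast (show 1 ≤ 2 * L - 1 by omega)
    have h0 : 0 ≤ ((d - 1 : ℕ) : ℝ) * ((L - 1 : ℕ) : ℝ) * a := by positivity
    calc ((d - 1 : ℕ) : ℝ) * ((L - 1 : ℕ) : ℝ) * a = ((d - 1 : ℕ) : ℝ) * ((L - 1 : ℕ) : ℝ) * a * 1 := (mul_one _).symm
      _ ≤ ((d - 1 : ℕ) : ℝ) * ((L - 1 : ℕ) : ℝ) * a * ((2 * L - 1 : ℕ) : ℝ) := mul_le_mul_of_nonneg_left h2L h0
      _ = m₁ := by ring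
  have hin : ∀ (y : Tor (fine n M)) (j : Fin d → Fin L) (μ : Fin d), (j μ : ℕ) + 1 < L →
      ‖S (bpt L (fine n M) y j) μ * star (taxiTv L (fine n M) S (bpt L (fine n M) y j + unitVec (fine L (fine n M)) μ)) - star (taxiTv L (fine n M) S (bpt L (fine n M) y j))‖ ≤ m₁ :=
    fun y j μ hj => (hin_taxiTv_le L (fine n M) hU ha y j μ hj).trans hLm1
  have hcross : ∀ (y : Tor (fine n M)) (j : Fin d → Fin L) (μ : Fin d), (j μ : ℕ) + 1 = L →
      ‖S (bpt L (fine n M) y j) μ * star (taxiTv L (fine n M) S (bpt L (fine n M) y j + unitVec (fine L (fine n M)) μ))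
        - star (taxiTv L (fine n M) S (bpt L (fine n M) y j)) * coarseTv L (fine n M) S y μ‖ ≤ m₁ :=
    fun y j μ hj => hcross_taxiTv_le L (fine n M) hU ha y j μ hj
  -- (G″) with the NESTED kernel on the fine side (gen 4)
  have h1 := avgG_projG_of_data n L M hT hUC haC0 haC hT hw0 hw₀ zero_lt_one hrel hsmall hw'0 hw' hT' hU hw₁ hsmall₁' hm hmis habsorb hm₁ hin hcross g
  -- the nested kernel IS the two-step taxi's kernel read on the composite torus
  rw [projG_compFibre_eq n L M S (taxiTv n M (coarseTv L (fine n M) S)) (taxiTv L (fine n M) S) g] at h1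
  -- the kernel swap two-step ↦ straight taxi, coefficient one
  have hUR : ∀ x μ, Rtrv n L M S x μ ∈ unitary (E →L[ℂ] E) := Rtrv_mem_unitary_of n L M hU
  have hT₁ : ∀ x, compTv n L M (taxiTv n M (coarseTv L (fine n M) S)) (taxiTv L (fine n M) S) x ∈ unitary (E →L[ℂ] E) := compTv_mem_unitary n L M hT hT'
  have hT₂ : ∀ x, taxiTv (n * L) M (Rtrv n L M S) x ∈ unitary (E →L[ℂ] E) := taxiTv_mem_unitary (n * L) M hUR
  have hτ : ∀ x, ‖compTv n L M (taxiTv n M (coarseTv L (fine n M) S)) (taxiTv L (fine n M) S) x - taxiTv (n * L) M (Rtrv n L M S) x‖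
      ≤ (d : ℝ) * ((d : ℝ) * (((L : ℝ) * ((n - 1 : ℕ) : ℝ) * ((L - 1 : ℕ) : ℝ)) * a)) := fun x => by
    rw [norm_sub_rev]; exact taxiTv_Rtrv_sub_compTv_le n L M hS1 ha x
  have hw₂0 : 0 ≤ ((d - 1 : ℕ) : ℝ) * ((n * L - 1 : ℕ) : ℝ) * a := by positivity
  have h2 := sqrt_projG_le_of_frames M hUR hT₁ hT₂ hτ (inBlock_defect_compTv_blockOf n L M hU ha haC hM2)
    (by simpa only [Nat.cast_mul] using hsmallcp) hw₂0 (inBlock_defect_taxiTv_Rtrv_blockOf n L M hU ha hM2) (g ∘ sites n L M)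
  rw [divSq_transport] at h2
  -- absorb the swap's price into `ρ′`
  have hc₁ : 0 ≤ (((n : ℝ) * L) ^ d)⁻¹ := by positivity
  have hc₂ : 0 ≤ ((n : ℝ) * L) ^ 2 := by positivity
  have hρD : 0 ≤ ρD := by
    have hH : 0 ≤ hessV (fine L (fine n M)) S g := by unfold hessV; exact sum_nonneg fun ν _ => hessv_nonneg _ _ _
    have hQ : 0 ≤ qVV n L M g := qVV_nonneg n L M g
    positivity
  have hδG : 0 ≤ δG := by
    have := revPC_nonneg (d := d) (n * L) (((d - 1 : ℕ) : ℝ) * ((n * L - 1 : ℕ) : ℝ) * a)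
    positivity
  have he : 0 ≤ εD + Real.sqrt (CP * eH) := by positivity
  exact sq_sqrt_swap_le hc₁ hc₂ hρD hδG he h1 h2

end Level

/-! ## §3 Along the taxi tower: the END's `hAVGG k` at every pair -/

section Tower

variable {E : Type*} [NormedAddCommGroup E] [InnerProductSpace ℂ E] [CompleteSpace E] [FiniteDimensional ℂ E]
variable (L : ℕ) [NeZero L] (M : Fin d → ℕ) [hM : ∀ μ, NeZero (M μ)]

/-- **THE END's (G″) SOCKET AT BAŁABAN's TAXI DATA, FROM OPERATOR DATA** (file 1's `hAVGG k` for parts 6–8's `G k := projG (Rlev k) (ker Q_{taxi,k})`,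
`G′ k := G (k+1) ∘ (· ∘ sites)`, AT EVERY PAIR `(Q_{T′ k} g, g)` — no minimality used): along a COHERENT tower of unitary one-step bonds (`coarseTv (R′ k) = Rlev k`,
`Rlev (k+1) = Rtrv (R′ k)`), level plaquette defects `a k`, one-step `b k`, the four per-level smallness lines displayed, §2 read at `n := L^k`, `S := R′ k`. [folklore] -/
theorem hAVGG_projG_nestLv (hM2 : ∀ μ, 1 < M μ) {R' : (k : ℕ) → Tor (fine L (fine (L ^ k) M)) → Fin d → (E →L[ℂ] E)}
    (hU : ∀ k x μ, R' k x μ ∈ unitary (E →L[ℂ] E)) {b a : ℕ → ℝ} (hb0 : ∀ k, 0 ≤ b k) (ha0 : ∀ k, 0 ≤ a k)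
    (hb : ∀ k x κ ι, ‖R' k x κ * R' k (x + unitVec (fine L (fine (L ^ k) M)) κ) ι - R' k x ι * R' k (x + unitVec (fine L (fine (L ^ k) M)) ι) κ‖ ≤ b k)
    (ha : ∀ k x κ ι, ‖Rlev L M R' k x κ * Rlev L M R' k (x + unitVec (fine (L ^ k) M) κ) ι - Rlev L M R' k x ι * Rlev L M R' k (x + unitVec (fine (L ^ k) M) ι) κ‖ ≤ a k)
    (hcoh : ∀ k, coarseTv L (fine (L ^ (k + 1)) M) (R' (k + 1)) = Rtrv (L ^ k) L M (R' k))
    (hsmallP : ∀ k, 2 * (d : ℝ) * ((((L ^ k : ℕ) : ℝ)) * (((d - 1 : ℕ) : ℝ) * ((L ^ k - 1 : ℕ) : ℝ) * a k)) ^ 2 ≤ 1 / 2)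
    (hsmall₁ : ∀ k, 2 * (d : ℝ) * ((L : ℝ) * (((d - 1 : ℕ) : ℝ) * ((L - 1 : ℕ) : ℝ) * b k)) ^ 2 ≤ 1 / 2)
    (habsorb : ∀ k, 64 * (d : ℝ) * ((((L ^ k : ℕ) : ℝ)) * (((d - 1 : ℕ) : ℝ) * L * ((L - 1 : ℕ) : ℝ) * b k)) ^ 2 ≤ 1 / 2)
    (hsmallcp : ∀ k, 2 * (d : ℝ) * ((((L ^ k * L : ℕ) : ℝ))
      * (((d - 1 : ℕ) : ℝ) * ((L - 1 : ℕ) : ℝ) * ((2 * L - 1 : ℕ) : ℝ) * b k + ((d - 1 : ℕ) : ℝ) * ((L ^ k - 1 : ℕ) : ℝ) * a k)) ^ 2 ≤ 1 / 2)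
    (k : ℕ) (g : Tor (fine L (fine (L ^ k) M)) → Fin d → E) :
    let n : ℕ := L ^ k
    let w₀ : ℝ := ((d - 1 : ℕ) : ℝ) * ((n - 1 : ℕ) : ℝ) * a k
    let w' : ℝ := w₀ + 3 / (n : ℝ)
    let m : ℝ := ((d - 1 : ℕ) : ℝ) * L * ((L - 1 : ℕ) : ℝ) * b k
    let m₁ : ℝ := ((d - 1 : ℕ) : ℝ) * ((L - 1 : ℕ) : ℝ) * ((2 * L - 1 : ℕ) : ℝ) * b k
    let Λc : ℝ := 2 * d * (36 : ℝ) ^ d * ((1 + n * w') ^ 2 + 9)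
    let CP : ℝ := 136
    let CR : ℝ := 2 * Λc + 2 * d * (a k * (n : ℝ) ^ 2) + (d : ℝ) ^ 2 * (a k * (n : ℝ) ^ 2) ^ 2 * CP
    let ε₁ : ℝ := ((d : ℝ) / 4 + 1 / 2) * ((L : ℝ) / (n : ℝ) ^ 2)
    let δ' : ℝ := Real.sqrt (2 * d * (1 + (d : ℝ) ^ 2)) * ((n : ℝ) * L * m₁)
    let Λ : ℝ := Λc + (ε₁ * CR + 2 * δ' * Real.sqrt ((1 + ε₁ * CR) * CP) + δ' ^ 2 * CP) * (Λc + 1)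
    let δ : ℝ := Real.sqrt d * ((n : ℝ) * m)
    let eH : ℝ := ePV Λ CP CR ε₁ δ' + eV Λ CP δ
    let εD : ℝ := Real.sqrt (3 * d) * (2 * (n : ℝ)⁻¹ + m + n * m)
    let δG : ℝ := 4 * ((d : ℝ) * ((d : ℝ) * (((L : ℝ) * ((n - 1 : ℕ) : ℝ) * ((L - 1 : ℕ) : ℝ)) * b k))) * revPC d (n * L) (((d - 1 : ℕ) : ℝ) * ((n * L - 1 : ℕ) : ℝ) * b k)
    let ρD : ℝ := (((n : ℝ) * L) ^ 4 / ((n : ℝ) * L) ^ d) * hessV (fine L (fine n M)) (R' k) g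
      + (((n : ℝ) * L) ^ 2 / ((n : ℝ) * L) ^ d) * ∑ μ : Fin d, ∑ x : Tor (fine L (fine n M)), ‖cdV (fine L (fine n M)) (R' k) g x μ μ‖ ^ 2 + qVV n L M g
    ((n : ℝ) ^ d)⁻¹ * ((n : ℝ) ^ 2 * projG (fine n M) (Rlev L M R' k) (LinearMap.ker (avgOp n M (taxiTv n M (Rlev L M R' k))))
        (QvL L (fine n M) (lineT L (fine n M) (taxiTv L (fine n M) (R' k)) (R' k)) g))
      ≤ (Real.sqrt ((((n : ℝ) * L) ^ d)⁻¹ * (((n : ℝ) * L) ^ 2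
              * projG (fine (L ^ (k + 1)) M) (Rlev L M R' (k + 1)) (LinearMap.ker (avgOp (L ^ (k + 1)) M (taxiTv (L ^ (k + 1)) M (Rlev L M R' (k + 1))))) (g ∘ sites n L M)))
          + (εD + Real.sqrt (CP * eH) + δG) * Real.sqrt (ρD + (((n : ℝ) * L) ^ d)⁻¹ * (((n : ℝ) * L) ^ 2 * divSq (fine L (fine n M)) (R' k) g))) ^ 2 := by
  have haC : ∀ y κ ι, ‖coarseTv L (fine (L ^ k) M) (R' k) y κ * coarseTv L (fine (L ^ k) M) (R' k) (y + unitVec (fine (L ^ k) M) κ) ι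
      - coarseTv L (fine (L ^ k) M) (R' k) y ι * coarseTv L (fine (L ^ k) M) (R' k) (y + unitVec (fine (L ^ k) M) ι) κ‖ ≤ a k := fun y κ ι => by
    rw [coarseTv_eq_Rlev L M R' hcoh k]; exact ha k y κ ι
  have h := avgG_projG_taxi (L ^ k) L M hM2 (hU k) (hb0 k) (ha0 k) (hb k) haC (hsmallP k) (hsmall₁ k) (habsorb k) (hsmallcp k) g
  rw [coarseTv_eq_Rlev L M R' hcoh k] at h
  exact h

end Tower

end Summit.QuantumFields.BalabanUV.T4Continuum.VariationalColourTaxiTowerAvgGData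

end
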